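import Literature.AnabelianGeometry.SemiGraphs.UniversalCoveringOver
import Literature.AnabelianGeometry.SemiGraphs.OrbitGraphOrbits
import Literature.AlgebraicGeometry.Frobenioids.QuasiTemperoidConnected
import HarnessLib

/-!
# Developing a split covering along `𝒢_{∞,F}` ([SemiAnbd] Def. 3.5 (ii), §3 p. 38) — transport

Mochizuki, *Semi-graphs of anabelioids*, §3 p. 37 (Def. 3.5 (ii)): a covering `S` (object of
`B^cov(𝒢)`) is tempered when each of its connected components is *split* by some finite étale
covering `F`: the stabilisers of the points of `F` fix the points of that component.  P. 38 then
dominates such components by the coverings `𝒢_{∞,F} → 𝒢` ("the covering of `𝒢_F` determined by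
the universal graph-covering of `𝔾_F`", `CovObj.univCoverOver`, `UniversalCoveringOver.lean`).

This file is the transport step of that domination (the *developing map*).  For a vertex-orbit
`V` of `F` (a vertex of `𝔾_F`) let `Dev V` be the set of `Π_v`-equivariant maps `V → S_v` with
values in the component of a fixed point `p₀` of `S` (`CovObj.DevV`; likewise `CovObj.DevE` over
edge-orbits).  A branch `b : E → V` of `𝔾_F` transports `f ∈ Dev E` to the equivariant map
`ρ g (glue_F y) ↦ ρ g (glue_S (f y))` (`CovObj.devFwd`); this is well defined precisely because
`F` splits `S` at the points of the component (`CovObj.devFwd_wd`), and it is a bijection with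
inverse `x ↦ glue_S⁻¹ (f' (glue_F x))` (`CovObj.devEquiv`).  The sequel
(`UniversalCoveringOverDevelopProofs.lean`) extends this to the fundamental groupoid of `𝔾_F` and
produces the morphism `𝒢_{∞,F} ⟶ S` through `p₀`.
-/

namespace Literature.AnabelianGeometry.SemiGraphs

namespace ProfiniteSemiGraph

open CategoryTheory
open Literature.AlgebraicGeometry.Frobenioids.QuasiTemperoid.BTempConnected (ρ_one_apply
  ρ_mul_apply ρ_inv_apply)

universe u

variable {𝒢 : ProfiniteSemiGraph.{u}}

/-! ### The gluing along a branch as a bijection, over any edge equal to the edge of the branch -/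

section Glue

variable (T : CovObj 𝒢) (b : 𝒢.graph.Branch) (w : 𝒢.graph.Vertex) (hw : 𝒢.graph.abuts b = some w)

/-- The gluing `S_e ≅ b^* S_w` along `b : e → w` as a bijection of underlying sets.
[cite: MochizukiSemiAnbd2006, Def 3.5(i) p.37] -/
noncomputable def CovObj.glueEquiv : (T.SE (𝒢.graph.edgeOf b)).obj.V ≃ (T.SV w).obj.V where
  toFun y := (T.glue b w hw).hom.hom.hom y
  invFun x := (T.glue b w hw).inv.hom.hom x
  left_inv := T.glue_inv_hom b w hw
  right_inv := T.glue_hom_inv b w hw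

/-- The gluing bijection over an edge `e` *equal to* the edge of `b` (avoids transporting points
along the equality). [cite: MochizukiSemiAnbd2006, Def 3.5(i) p.37] -/
noncomputable def CovObj.glueGen :
    ∀ (e : 𝒢.graph.Edge), 𝒢.graph.edgeOf b = e → ((T.SE e).obj.V ≃ (T.SV w).obj.V)
  | _, rfl => T.glueEquiv b w hw

/-- `glueGen` over the edge of `b` itself is the gluing. [cite: MochizukiSemiAnbd2006, Def 3.5(i) p.37] -/
theorem CovObj.glueGen_rfl : T.glueGen b w hw (𝒢.graph.edgeOf b) rfl = T.glueEquiv b w hw := rfl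

/-- The gluing bijection is the gluing map. [cite: MochizukiSemiAnbd2006, Def 3.5(i) p.37] -/
theorem CovObj.glueEquiv_apply (y : (T.SE (𝒢.graph.edgeOf b)).obj.V) :
    T.glueEquiv b w hw y = (T.glue b w hw).hom.hom.hom y := rfl

/-- Equivariance of the gluing bijection: `glue (k · y) = b_*(k) · glue y`.
[cite: MochizukiSemiAnbd2006, Def 3.5(i) p.37] -/
theorem CovObj.glueEquiv_ρ (k : 𝒢.Ge (𝒢.graph.edgeOf b)) (y : (T.SE (𝒢.graph.edgeOf b)).obj.V) :
    T.glueEquiv b w hw ((T.SE (𝒢.graph.edgeOf b)).obj.ρ k y) =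
      (T.SV w).obj.ρ (𝒢.brHom b w hw k) (T.glueEquiv b w hw y) :=
  T.glue_ρ b w hw k y

/-- Equivariance of the inverse gluing bijection. [cite: MochizukiSemiAnbd2006, Def 3.5(i) p.37] -/
theorem CovObj.glueEquiv_symm_ρ (k : 𝒢.Ge (𝒢.graph.edgeOf b)) (x : (T.SV w).obj.V) :
    (T.glueEquiv b w hw).symm ((T.SV w).obj.ρ (𝒢.brHom b w hw k) x) =
      (T.SE (𝒢.graph.edgeOf b)).obj.ρ k ((T.glueEquiv b w hw).symm x) := by
  apply (T.glueEquiv b w hw).injective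
  rw [Equiv.apply_symm_apply, CovObj.glueEquiv_ρ, Equiv.apply_symm_apply]

end Glue

/-! ### Equivariant developments over the orbits of `F` -/

section Dev

variable (F S : CovObj 𝒢) (p₀ : S.Point)

/-- `Dev V` for a vertex-orbit `V` of `F`: the `Π`-equivariant maps from (the points of) `V` to the
vertex fibres of `S`, with values in the connected component of `p₀` (a point of `V` is presented
as a vertex `w`, a point `x ∈ F_w` and a proof that its orbit is `V`).
[cite: MochizukiSemiAnbd2006, Def 3.5(ii) p.37] -/
def CovObj.DevV (V : F.OVertex) : Type u :=
  { f : ∀ (w : 𝒢.graph.Vertex) (x : (F.SV w).obj.V),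
      (Quot.mk F.VRel ⟨w, x⟩ : F.OVertex) = V → (S.SV w).obj.V //
    (∀ (w : 𝒢.graph.Vertex) (x : (F.SV w).obj.V) (h : (Quot.mk F.VRel ⟨w, x⟩ : F.OVertex) = V)
        (g : 𝒢.Gv w) (h' : (Quot.mk F.VRel ⟨w, (F.SV w).obj.ρ g x⟩ : F.OVertex) = V),
        f w ((F.SV w).obj.ρ g x) h' = (S.SV w).obj.ρ g (f w x h)) ∧
      ∀ (w : 𝒢.graph.Vertex) (x : (F.SV w).obj.V) (h : (Quot.mk F.VRel ⟨w, x⟩ : F.OVertex) = V),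
        S.SameComponent p₀ (Sum.inl ⟨w, f w x h⟩) }

/-- `Dev E` for an edge-orbit `E` of `F`: the `Π`-equivariant maps from `E` to the edge fibres of
`S` with values in the component of `p₀`. [cite: MochizukiSemiAnbd2006, Def 3.5(ii) p.37] -/
def CovObj.DevE (E : F.OEdge) : Type u :=
  { f : ∀ (e : 𝒢.graph.Edge) (y : (F.SE e).obj.V),
      (Quot.mk F.ERel ⟨e, y⟩ : F.OEdge) = E → (S.SE e).obj.V //
    (∀ (e : 𝒢.graph.Edge) (y : (F.SE e).obj.V) (h : (Quot.mk F.ERel ⟨e, y⟩ : F.OEdge) = E)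
        (g : 𝒢.Ge e) (h' : (Quot.mk F.ERel ⟨e, (F.SE e).obj.ρ g y⟩ : F.OEdge) = E),
        f e ((F.SE e).obj.ρ g y) h' = (S.SE e).obj.ρ g (f e y h)) ∧
      ∀ (e : 𝒢.graph.Edge) (y : (F.SE e).obj.V) (h : (Quot.mk F.ERel ⟨e, y⟩ : F.OEdge) = E),
        S.SameComponent p₀ (Sum.inr ⟨e, f e y h⟩) }

/-- `Dev` on the components of `𝔾_F` (objects of `Cat(𝔾_F)`). [cite: MochizukiSemiAnbd2006, Def 3.5(ii) p.37] -/
def CovObj.Dev : F.orbitGraph.CatCarrier → Type u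
  | Sum.inl V => F.DevV S p₀ V
  | Sum.inr E => F.DevE S p₀ E

end Dev

/-! ### Transport along a branch of `𝔾_F` -/

section Transport

variable {F S : CovObj 𝒢} {p₀ : S.Point}
variable (b : 𝒢.graph.Branch) (E : F.OEdge) (hbE : CovObj.OEdge.base F E = 𝒢.graph.edgeOf b)
  (V : F.OVertex) (hV : F.orbitGraph.abuts ⟨(b, E), hbE⟩ = some V)

include hV in
/-- The branch `b` abuts to the vertex under `V`. [cite: MochizukiSemiAnbd2006, Def 3.5(i) p.37] -/
theorem CovObj.abuts_base_of_orbit_abuts :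
    𝒢.graph.abuts b = some (CovObj.OVertex.base F V) := by
  rcases hab : 𝒢.graph.abuts b with _ | v
  · rw [F.orbitGraph_abuts_of_none b E hbE hab] at hV
    exact absurd hV (by simp)
  · rw [F.orbitGraph_abuts_of_abuts b E hbE v hab] at hV
    rw [F.base_of_glueOpt_eq_some b v hab E V hV]

include hV in
/-- `V` is the orbit `glue_b E`. [cite: MochizukiSemiAnbd2006, Def 3.5(i) p.37] -/
theorem CovObj.glueOpt_eq_of_orbit_abuts :
    F.glueOpt b _ (CovObj.abuts_base_of_orbit_abuts b E hbE V hV) E = some V :=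
  (F.orbitGraph_abuts_of_abuts b E hbE _ (CovObj.abuts_base_of_orbit_abuts b E hbE V hV)).symm.trans
    hV

include hbE in
/-- The edge of a representative of `E` is the edge of `b`. [cite: MochizukiSemiAnbd2006, Def 3.5(i) p.37] -/
theorem CovObj.edgeOf_eq_of_mk_eq {e : 𝒢.graph.Edge} {y : (F.SE e).obj.V}
    (hy : (Quot.mk F.ERel ⟨e, y⟩ : F.OEdge) = E) : 𝒢.graph.edgeOf b = e := by
  rw [← hbE, ← hy]
  rfl

include hV in
/-- `V` is the orbit of the glued image of any representative of `E` (over the edge of `b`).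
[cite: MochizukiSemiAnbd2006, Def 3.5(i) p.37] -/
theorem CovObj.eq_mk_glueEquiv (y : (F.SE (𝒢.graph.edgeOf b)).obj.V)
    (hy : (Quot.mk F.ERel ⟨𝒢.graph.edgeOf b, y⟩ : F.OEdge) = E) :
    (Quot.mk F.VRel ⟨_, F.glueEquiv b _ (CovObj.abuts_base_of_orbit_abuts b E hbE V hV) y⟩ :
      F.OVertex) = V := by
  have h := CovObj.glueOpt_eq_of_orbit_abuts b E hbE V hV
  revert h
  subst hy
  intro h
  rw [F.glueOpt_mk] at h
  exact Option.some.inj h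

include hV in
/-- `V` is the orbit of the glued image of any representative of `E`.
[cite: MochizukiSemiAnbd2006, Def 3.5(i) p.37] -/
theorem CovObj.eq_mk_glueGen {e : 𝒢.graph.Edge} (he : 𝒢.graph.edgeOf b = e) (y : (F.SE e).obj.V)
    (hy : (Quot.mk F.ERel ⟨e, y⟩ : F.OEdge) = E) :
    (Quot.mk F.VRel ⟨_, F.glueGen b _ (CovObj.abuts_base_of_orbit_abuts b E hbE V hV) e he y⟩ :
      F.OVertex) = V := by
  subst he
  exact CovObj.eq_mk_glueEquiv b E hbE V hV y hy

/-- Values of a development do not depend on the presentation of the point.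
[cite: MochizukiSemiAnbd2006, Def 3.5(ii) p.37] -/
theorem CovObj.DevV.apply_congr (f' : F.DevV S p₀ V) {w : 𝒢.graph.Vertex} {x x' : (F.SV w).obj.V}
    (hx : x = x') (h : (Quot.mk F.VRel ⟨w, x⟩ : F.OVertex) = V)
    (h' : (Quot.mk F.VRel ⟨w, x'⟩ : F.OVertex) = V) : f'.1 w x h = f'.1 w x' h' := by
  subst hx
  rfl

/-- A *forward witness* for a point `x` of the orbit `V` relative to the branch `b : E → V`:
`x = g · glue_b (y)` with `y ∈ E`. [cite: MochizukiSemiAnbd2006, Def 3.5(ii) p.37] -/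
structure CovObj.FwdWitness (w : 𝒢.graph.Vertex) (x : (F.SV w).obj.V) where
  /-- the edge carrying the representative -/
  e : 𝒢.graph.Edge
  /-- it is the edge of `b` -/
  he : 𝒢.graph.edgeOf b = e
  /-- the representative of `E` -/
  y : (F.SE e).obj.V
  /-- it represents `E` -/
  hy : (Quot.mk F.ERel ⟨e, y⟩ : F.OEdge) = E
  /-- `b` abuts to `w` -/
  hw : 𝒢.graph.abuts b = some w
  /-- the group element -/
  g : 𝒢.Gv w
  /-- `x = g · glue_b y` -/
  hx : x = (F.SV w).obj.ρ g (F.glueGen b w hw e he y)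

include hV in
/-- Every point of `V` has a forward witness. [cite: MochizukiSemiAnbd2006, Def 3.5(ii) p.37] -/
theorem CovObj.nonempty_fwdWitness (w : 𝒢.graph.Vertex) (x : (F.SV w).obj.V)
    (h : (Quot.mk F.VRel ⟨w, x⟩ : F.OVertex) = V) : Nonempty (CovObj.FwdWitness b E w x) := by
  have hwV : w = CovObj.OVertex.base F V := by rw [← h]; rfl
  subst hwV
  obtain ⟨y, hy⟩ := CovObj.OEdge.exists_rep F E
  have he : 𝒢.graph.edgeOf b = CovObj.OEdge.base F E := hbE.symm
  have hw := CovObj.abuts_base_of_orbit_abuts b E hbE V hV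
  have hV' := CovObj.eq_mk_glueGen b E hbE V hV he y hy
  obtain ⟨g, hg⟩ := F.exists_ρ_of_mk_eq_mk (hV'.trans h.symm)
  exact ⟨⟨_, he, y, hy, hw, g, hg.symm⟩⟩

/-- **Well-definedness of the forward transport**: the value `g · glue_S (f y)` does not depend on
the forward witness `(y, g)` of `x` — this is where the splitting of `S` by `F` at the points of the
component of `p₀` enters. [cite: MochizukiSemiAnbd2006, Def 3.5(ii) p.37] -/
theorem CovObj.devFwd_wd (hsplit : ∀ q, S.SameComponent p₀ q → F.SplitsAt S q) (f : F.DevE S p₀ E)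
    {w : 𝒢.graph.Vertex} {x : (F.SV w).obj.V} (W W' : CovObj.FwdWitness b E w x) :
    (S.SV w).obj.ρ W.g (S.glueGen b w W.hw W.e W.he (f.1 W.e W.y W.hy)) =
      (S.SV w).obj.ρ W'.g (S.glueGen b w W'.hw W'.e W'.he (f.1 W'.e W'.y W'.hy)) := by
  obtain ⟨e, he, y, hy, hw, g, hx⟩ := W
  obtain ⟨e', he', y', hy', hw', g', hx'⟩ := W'
  subst he
  subst he'
  change (S.SV w).obj.ρ g (S.glueEquiv b w hw (f.1 _ y hy)) =
    (S.SV w).obj.ρ g' (S.glueEquiv b w hw (f.1 _ y' hy'))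
  change x = (F.SV w).obj.ρ g (F.glueEquiv b w hw y) at hx
  change x = (F.SV w).obj.ρ g' (F.glueEquiv b w hw y') at hx'
  obtain ⟨k, rfl⟩ := F.exists_ρE_of_mk_eq_mk (hy.trans hy'.symm)
  -- the element `g⁻¹ g' b_*(k)` stabilises `glue_F y`
  have hfix : (F.SV w).obj.ρ (g⁻¹ * (g' * 𝒢.brHom b w hw k)) (F.glueEquiv b w hw y) =
      F.glueEquiv b w hw y := by
    rw [ρ_mul_apply, ρ_mul_apply, ← F.glueEquiv_ρ, ← hx', hx, ρ_inv_apply]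
  -- the point `t = glue_S (f y)` lies in the component of `p₀`, so it is fixed by that element
  set t := S.glueEquiv b w hw (f.1 _ y hy) with ht
  have hcomp : S.SameComponent p₀ (Sum.inl ⟨w, t⟩) :=
    (f.2.2 _ y hy).trans _ _ _ (Relation.EqvGen.rel _ _ (CovObj.Adj.glue b w hw (f.1 _ y hy)))
  have hst : (S.SV w).obj.ρ (g⁻¹ * (g' * 𝒢.brHom b w hw k)) t = t :=
    hsplit _ hcomp (F.glueEquiv b w hw y) _ hfix
  rw [f.2.1 _ y hy k hy', S.glueEquiv_ρ, ← ht, ← ρ_mul_apply]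
  conv_lhs => rw [← hst, ← ρ_mul_apply, ← mul_assoc, mul_inv_cancel, one_mul]

/-- The forward transport of `f ∈ Dev E` along `b : E → V`, as a bare function: at a point `x` of
`V`, the common value `g · glue_S (f y)` over the forward witnesses of `x`.
[cite: MochizukiSemiAnbd2006, Def 3.5(ii) p.37] -/
noncomputable def CovObj.devFwdFun (f : F.DevE S p₀ E) (w : 𝒢.graph.Vertex) (x : (F.SV w).obj.V)
    (h : (Quot.mk F.VRel ⟨w, x⟩ : F.OVertex) = V) : (S.SV w).obj.V :=
  let W := Classical.choice (CovObj.nonempty_fwdWitness b E hbE V hV w x h)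
  (S.SV w).obj.ρ W.g (S.glueGen b w W.hw W.e W.he (f.1 W.e W.y W.hy))

/-- The forward transport evaluated through any forward witness.
[cite: MochizukiSemiAnbd2006, Def 3.5(ii) p.37] -/
theorem CovObj.devFwdFun_eq (hsplit : ∀ q, S.SameComponent p₀ q → F.SplitsAt S q)
    (f : F.DevE S p₀ E) {w : 𝒢.graph.Vertex} {x : (F.SV w).obj.V}
    (h : (Quot.mk F.VRel ⟨w, x⟩ : F.OVertex) = V) (W : CovObj.FwdWitness b E w x) :
    CovObj.devFwdFun b E hbE V hV f w x h =
      (S.SV w).obj.ρ W.g (S.glueGen b w W.hw W.e W.he (f.1 W.e W.y W.hy)) :=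
  CovObj.devFwd_wd b E hsplit f _ W

/-- The forward transport at a glued point: `devFwd f (glue_F y) = glue_S (f y)`.
[cite: MochizukiSemiAnbd2006, Def 3.5(ii) p.37] -/
theorem CovObj.devFwdFun_glue (hsplit : ∀ q, S.SameComponent p₀ q → F.SplitsAt S q)
    (f : F.DevE S p₀ E) {e : 𝒢.graph.Edge} (he : 𝒢.graph.edgeOf b = e) (y : (F.SE e).obj.V)
    (hy : (Quot.mk F.ERel ⟨e, y⟩ : F.OEdge) = E) {w : 𝒢.graph.Vertex}
    (hw : 𝒢.graph.abuts b = some w)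
    (h : (Quot.mk F.VRel ⟨w, F.glueGen b w hw e he y⟩ : F.OVertex) = V) :
    CovObj.devFwdFun b E hbE V hV f w (F.glueGen b w hw e he y) h =
      S.glueGen b w hw e he (f.1 e y hy) := by
  rw [CovObj.devFwdFun_eq b E hbE V hV hsplit f h ⟨e, he, y, hy, hw, 1, (ρ_one_apply _ _).symm⟩]
  exact ρ_one_apply _ _

/-- **The forward transport** `Dev E → Dev V` along the branch `b : E → V` of `𝔾_F`.
[cite: MochizukiSemiAnbd2006, Def 3.5(ii) p.37] -/
noncomputable def CovObj.devFwd (hsplit : ∀ q, S.SameComponent p₀ q → F.SplitsAt S q)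
    (f : F.DevE S p₀ E) : F.DevV S p₀ V :=
  ⟨CovObj.devFwdFun b E hbE V hV f, by
    refine ⟨fun w x h g h' => ?_, fun w x h => ?_⟩
    · obtain ⟨W⟩ := CovObj.nonempty_fwdWitness b E hbE V hV w x h
      rw [CovObj.devFwdFun_eq b E hbE V hV hsplit f h W,
        CovObj.devFwdFun_eq b E hbE V hV hsplit f h'
          ⟨W.e, W.he, W.y, W.hy, W.hw, g * W.g, by rw [ρ_mul_apply, ← W.hx]⟩, ρ_mul_apply]
    · obtain ⟨W⟩ := CovObj.nonempty_fwdWitness b E hbE V hV w x h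
      rw [CovObj.devFwdFun_eq b E hbE V hV hsplit f h W]
      obtain ⟨e, he, y, hy, hw, g, hx⟩ := W
      subst he
      exact ((f.2.2 _ y hy).trans _ _ _
        (Relation.EqvGen.rel _ _ (CovObj.Adj.glue b w hw (f.1 _ y hy)))).trans _ _ _
        (Relation.EqvGen.rel _ _ (CovObj.Adj.vertex w g _))⟩

/-- The backward transport `Dev V → Dev E` along `b : E → V`, as a bare function:
`y ↦ glue_S⁻¹ (f' (glue_F y))`. [cite: MochizukiSemiAnbd2006, Def 3.5(ii) p.37] -/
noncomputable def CovObj.devBwdFun (f' : F.DevV S p₀ V) (e : 𝒢.graph.Edge) (y : (F.SE e).obj.V)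
    (hy : (Quot.mk F.ERel ⟨e, y⟩ : F.OEdge) = E) : (S.SE e).obj.V :=
  (S.glueGen b _ (CovObj.abuts_base_of_orbit_abuts b E hbE V hV) e
      (CovObj.edgeOf_eq_of_mk_eq b E hbE hy)).symm
    (f'.1 _ (F.glueGen b _ (CovObj.abuts_base_of_orbit_abuts b E hbE V hV) e
      (CovObj.edgeOf_eq_of_mk_eq b E hbE hy) y)
      (CovObj.eq_mk_glueGen b E hbE V hV _ y hy))

/-- **The backward transport** `Dev V → Dev E` along `b : E → V`.
[cite: MochizukiSemiAnbd2006, Def 3.5(ii) p.37] -/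
noncomputable def CovObj.devBwd (f' : F.DevV S p₀ V) : F.DevE S p₀ E :=
  ⟨CovObj.devBwdFun b E hbE V hV f', by
    have hw := CovObj.abuts_base_of_orbit_abuts b E hbE V hV
    refine ⟨fun e y hy k hy' => ?_, fun e y hy => ?_⟩
    · have he := CovObj.edgeOf_eq_of_mk_eq b E hbE hy
      subst he
      have p2 := CovObj.eq_mk_glueEquiv b E hbE V hV y hy
      have h3 : (Quot.mk F.VRel
          ⟨_, (F.SV _).obj.ρ (𝒢.brHom b _ hw k) (F.glueEquiv b _ hw y)⟩ : F.OVertex) = V := by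
        rw [← F.glueEquiv_ρ]
        exact CovObj.eq_mk_glueEquiv b E hbE V hV _ hy'
      change (S.glueEquiv b _ hw).symm (f'.1 _ (F.glueEquiv b _ hw ((F.SE _).obj.ρ k y))
          (CovObj.eq_mk_glueEquiv b E hbE V hV _ hy')) =
        (S.SE _).obj.ρ k ((S.glueEquiv b _ hw).symm (f'.1 _ (F.glueEquiv b _ hw y) p2))
      rw [CovObj.DevV.apply_congr V f' (F.glueEquiv_ρ b _ hw k y) _ h3, f'.2.1 _ _ p2 _ h3,
        S.glueEquiv_symm_ρ]
    · have he := CovObj.edgeOf_eq_of_mk_eq b E hbE hy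
      subst he
      change S.SameComponent p₀ (Sum.inr ⟨_, (S.glueEquiv b _ hw).symm
        (f'.1 _ (F.glueEquiv b _ hw y) (CovObj.eq_mk_glueGen b E hbE V hV rfl y hy))⟩)
      refine (f'.2.2 _ _ (CovObj.eq_mk_glueGen b E hbE V hV rfl y hy)).trans _ _ _
        (Relation.EqvGen.symm _ _ (Relation.EqvGen.rel _ _ ?_))
      have hA := CovObj.Adj.glue (S := S) b _ hw ((S.glueEquiv b _ hw).symm
        (f'.1 _ (F.glueEquiv b _ hw y) (CovObj.eq_mk_glueGen b E hbE V hV rfl y hy)))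
      rwa [← CovObj.glueEquiv_apply, Equiv.apply_symm_apply] at hA⟩

/-- `devBwd ∘ devFwd = id`. [cite: MochizukiSemiAnbd2006, Def 3.5(ii) p.37] -/
theorem CovObj.devBwd_devFwd (hsplit : ∀ q, S.SameComponent p₀ q → F.SplitsAt S q)
    (f : F.DevE S p₀ E) :
    CovObj.devBwd b E hbE V hV (CovObj.devFwd b E hbE V hV hsplit f) = f := by
  apply Subtype.ext
  funext e y hy
  change (S.glueGen b _ _ e _).symm (CovObj.devFwdFun b E hbE V hV f _ (F.glueGen b _ _ e _ y)
    (CovObj.eq_mk_glueGen b E hbE V hV _ y hy)) = _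
  rw [CovObj.devFwdFun_glue b E hbE V hV hsplit f _ y hy, Equiv.symm_apply_apply]

/-- `devFwd ∘ devBwd = id`. [cite: MochizukiSemiAnbd2006, Def 3.5(ii) p.37] -/
theorem CovObj.devFwd_devBwd (hsplit : ∀ q, S.SameComponent p₀ q → F.SplitsAt S q)
    (f' : F.DevV S p₀ V) :
    CovObj.devFwd b E hbE V hV hsplit (CovObj.devBwd b E hbE V hV f') = f' := by
  apply Subtype.ext
  funext w x h
  obtain ⟨W⟩ := CovObj.nonempty_fwdWitness b E hbE V hV w x h
  change CovObj.devFwdFun b E hbE V hV _ w x h = _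
  rw [CovObj.devFwdFun_eq b E hbE V hV hsplit _ h W]
  obtain ⟨e, he, y, hy, hw, g, hx⟩ := W
  subst he
  have hwV : w = CovObj.OVertex.base F V := by rw [← h]; rfl
  subst hwV
  subst hx
  change (S.SV _).obj.ρ g (S.glueEquiv b _ hw ((S.glueEquiv b _ hw).symm
    (f'.1 _ (F.glueEquiv b _ hw y) (CovObj.eq_mk_glueEquiv b E hbE V hV y hy)))) =
    f'.1 _ ((F.SV _).obj.ρ g (F.glueEquiv b _ hw y)) h
  rw [Equiv.apply_symm_apply]
  exact (f'.2.1 _ _ _ g h).symm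

/-- **Transport along a branch is a bijection** `Dev E ≃ Dev V`.
[cite: MochizukiSemiAnbd2006, Def 3.5(ii) p.37] -/
noncomputable def CovObj.devEquiv (hsplit : ∀ q, S.SameComponent p₀ q → F.SplitsAt S q) :
    F.DevE S p₀ E ≃ F.DevV S p₀ V where
  toFun := CovObj.devFwd b E hbE V hV hsplit
  invFun := CovObj.devBwd b E hbE V hV
  left_inv := CovObj.devBwd_devFwd b E hbE V hV hsplit
  right_inv := CovObj.devFwd_devBwd b E hbE V hV hsplit

end Transport

end ProfiniteSemiGraph

end Literature.AnabelianGeometry.SemiGraphs
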